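import Literature.NumberTheory.ModularForms.GammaTranslatesGalois
import HarnessLib

/-!
# The `q`-expansion principle for `SL₂(ℤ)`-translates, Galois-action half: the conjugate of
# `g ∣ γ` is `g ∣ γ'`, `γ' ≡ diag(1,d)⁻¹ γ diag(1,d) (mod N)`, for `σ(ζ_N) = ζ_N^d`

Topic `Literature/NumberTheory/ModularForms`; namespace `Literature.NumberTheory.ModularForms`.
Conclusion of `GammaTranslatesGalois` (set-up) on top of `GammaTranslates{Setup,Cramer,Descent,Rational}`
(there: the RATIONALITY half, Shimura Thm. 6.6 / Prop. 6.9).  Here the ACTION of `Aut(ℂ)` on the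
expansions at the other cusps (Shimura 1971, §6.2: the action `x ↦ x^{ι(1,d)}` of `GL₂(ℤ/Nℤ)` on
`𝔉_N` composed with `τ ↦ γτ`; Diamond–Shurman §7.7; Stevens 1982 Thm. 1.3.1 for the cusps):

* `qExpansion_slash_conj_of_even`, **`qExpansion_slash_conj`** — for `g ∈ M_k(Γ(N))` whose
  `q_N`-expansion is FIXED by a ring endomorphism `σ` of `ℂ` with `σ(e^{2πi/N}) = e^{2πid/N}`,
  `dd' ≡ 1 (N)`, and `γ, γ' ∈ SL₂(ℤ)` with `γ' ≡ (a, db; d'c, δ) (mod N)` where `γ = (a, b; c, δ)`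
  (i.e. `γ' ≡ diag(1,d') γ diag(1,d)`):  `qExpansion N (g ∣_k γ') = σ(qExpansion N (g ∣_k γ))`.

Proof (even weight): the orbit datum of `isRat_slash_of_even` — translates `s_i = θ ∣ γ_i` of a
generic RATIONAL combination `θ = ∑ λ_u c₄G_4^u` and companions `F_i = g ∣ γ_i` — is run
`σ`-equivariantly: the conjugate of `s_i` is `s'_i = θ' ∣ γ'_i` (`θ' = ∑ λ_u c₄G_4^{u diag(1,d)}`,
`EisensteinLatticeCosetGalois`), the Cramer identity `δ²F_i = ∑_l s_i^l M_l` (`M_l = δ·cram_l` of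
level one) conjugates to `σ(δ²F_i) = ∑_l σ(s_i)^l σ(M_l)`, the right side is the expansion of the
genuine form `∑_l (s'_i)^l M_l^{(σ)}`, which at `i = i₀` (`F_{i₀} = g`, `σ`-fixed) equals `δ'² g`
and hence, slashing by `γ'_i`, equals `δ'²(g ∣ γ'_i)` for every `i`; dividing by `σ(δ²) = δ'² ≢ 0`
gives `σ(F_i) = g ∣ γ'_i`.  Odd weight: multiply by `c₃G_3^{(1,0)}` (`σ`-fixed, non-vanishing
translates) and divide.

Everything is proved (no definition, no named fact).

## References

* [ShimuraIATAF1971] G. Shimura, *Introduction to the arithmetic theory of automorphic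
  functions*, Princeton (1971), §6.1–6.2: Thm. 6.6, Prop. 6.9, and the `GL₂(ℤ/Nℤ)`-action on `𝔉_N`.
* [DiamondShurman2005] F. Diamond, J. Shurman, *A First Course in Modular Forms*, GTM 228
  (2005), §7.7.
* [Stevens1982] G. Stevens, *Arithmetic on Modular Curves*, Progress in Math. 20 (1982), §1.3
  Thm. 1.3.1 (the case of the cusps).
-/

noncomputable section

namespace Literature.NumberTheory.ModularForms

open scoped MatrixGroups Real CongruenceSubgroup Matrix ModularForm Topology Manifold
open UpperHalfPlane hiding I
open Complex Filter Function ModularForm PowerSeries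
open Literature.NumberTheory.EllipticCurves.ModularForms (formSpace levelOneSpace mem_formSpace
  mem_formSpace_iff coe_mem_formSpace mul_mem_formSpace pow_mem_formSpace formSpace_mono
  mdifferentiable_of_mem_formSpace slash_eq_of_mem_formSpace isBoundedAtImInfty_slash_of_mem_formSpace
  eq_zero_of_mul_eq_zero_of_mdifferentiable specialLinearGroup_map_surjective formSpace_eq_bot_of_odd
  formSpace_eq_bot_of_neg)

/-! ### The rational subfield -/

section RatSubfield

/-- Every ring endomorphism of `ℂ` fixes the rational subfield `ℚ ⊆ ℂ`
(`(⊥ : IntermediateField ℚ ℂ)`). [folklore] -/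
private theorem ringHom_apply_eq_self_of_mem_bot (σ : ℂ →+* ℂ) (x : ℂ)
    (hx : x ∈ (⊥ : IntermediateField ℚ ℂ).toSubfield) : σ x = x := by
  rw [IntermediateField.mem_toSubfield, IntermediateField.mem_bot] at hx
  obtain ⟨q, rfl⟩ := hx
  rw [show algebraMap ℚ ℂ q = (q : ℂ) from rfl, map_ratCast]

end RatSubfield

/-! ### Conjugation by `diag(1,d)` on `SL₂(ℤ/Nℤ)` -/

section Conj

variable {N : ℕ} {d d' : ℤ}

/-- The entries of `D' M D` (`D = diag(1,d)`, `D' = diag(1,d')`): `(M₀₀, M₀₁ d; d' M₁₀, d' M₁₁ d)`.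
[cite: ShimuraIATAF1971, §6.2 (the elements `ι(1,d)` of `GL₂(ℤ/Nℤ)`)] -/
theorem diagConj_entries (M : Matrix (Fin 2) (Fin 2) (ZMod N)) :
    (Matrix.diagonal ![1, (d' : ZMod N)] * M * Matrix.diagonal ![1, (d : ZMod N)]) 0 0 = M 0 0 ∧
    (Matrix.diagonal ![1, (d' : ZMod N)] * M * Matrix.diagonal ![1, (d : ZMod N)]) 0 1 = M 0 1 * d ∧
    (Matrix.diagonal ![1, (d' : ZMod N)] * M * Matrix.diagonal ![1, (d : ZMod N)]) 1 0 = d' * M 1 0 ∧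
    (Matrix.diagonal ![1, (d' : ZMod N)] * M * Matrix.diagonal ![1, (d : ZMod N)]) 1 1 = d' * M 1 1 * d := by
  simp only [Matrix.mul_diagonal, Matrix.diagonal_mul, Matrix.cons_val_zero, Matrix.cons_val_one,
    Matrix.cons_val_fin_one, one_mul, mul_one]
  exact ⟨trivial, trivial, trivial, trivial⟩

/-- Entries of the reduction mod `N`. [cite: ShimuraIATAF1971, §6.2 (reduction `SL₂(ℤ) → SL₂(ℤ/Nℤ)`)] -/
theorem specialLinearGroup_map_apply (γ : SL(2, ℤ)) (i j : Fin 2) :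
    ((Matrix.SpecialLinearGroup.map (Int.castRingHom (ZMod N))) γ : Matrix (Fin 2) (Fin 2) (ZMod N)) i j =
      ((γ i j : ℤ) : ZMod N) := by
  simp

/-- The reduction mod `N` commutes with `-1`. [cite: ShimuraIATAF1971, §6.2 (reduction `SL₂(ℤ) → SL₂(ℤ/Nℤ)`)] -/
theorem specialLinearGroup_map_neg (γ : SL(2, ℤ)) :
    (Matrix.SpecialLinearGroup.map (Int.castRingHom (ZMod N))) (-γ) =
      -(Matrix.SpecialLinearGroup.map (Int.castRingHom (ZMod N))) γ := by
  apply Subtype.ext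
  ext i j
  simp

/-- Multiplicativity of `g ↦ D' g D` (`DD' = 1`), as a matrix identity.
[cite: ShimuraIATAF1971, §6.2 (the elements `ι(1,d)` of `GL₂(ℤ/Nℤ)`)] -/
theorem diagConj_mul (hdd : ((d * d' : ℤ) : ZMod N) = 1) (g h : Matrix (Fin 2) (Fin 2) (ZMod N)) :
    Matrix.diagonal ![1, (d' : ZMod N)] * (g * h) * Matrix.diagonal ![1, (d : ZMod N)] =
      (Matrix.diagonal ![1, (d' : ZMod N)] * g * Matrix.diagonal ![1, (d : ZMod N)]) *
        (Matrix.diagonal ![1, (d' : ZMod N)] * h * Matrix.diagonal ![1, (d : ZMod N)]) := by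
  obtain ⟨hDD', -⟩ := diagonal_mul_diagonal_eq_one (N := N) hdd
  rw [show Matrix.diagonal ![1, (d' : ZMod N)] * g * Matrix.diagonal ![1, (d : ZMod N)] *
      (Matrix.diagonal ![1, (d' : ZMod N)] * h * Matrix.diagonal ![1, (d : ZMod N)]) =
      Matrix.diagonal ![1, (d' : ZMod N)] * g *
        (Matrix.diagonal ![1, (d : ZMod N)] * Matrix.diagonal ![1, (d' : ZMod N)]) * h * Matrix.diagonal ![1, (d : ZMod N)] by
      simp only [Matrix.mul_assoc], hDD', Matrix.mul_one]
  simp only [Matrix.mul_assoc]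

/-- The inverse direction `g ↦ D g D'` undoes `g ↦ D' g D`.
[cite: ShimuraIATAF1971, §6.2 (the elements `ι(1,d)` of `GL₂(ℤ/Nℤ)`)] -/
theorem diagConj_inv (hdd : ((d * d' : ℤ) : ZMod N) = 1) (g : SL(2, ZMod N)) :
    Matrix.diagonal ![1, (d' : ZMod N)] *
        (Matrix.diagonal ![1, (d : ZMod N)] * (g : Matrix (Fin 2) (Fin 2) (ZMod N)) * Matrix.diagonal ![1, (d' : ZMod N)]) *
        Matrix.diagonal ![1, (d : ZMod N)] = (g : Matrix (Fin 2) (Fin 2) (ZMod N)) := by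
  obtain ⟨hDD', hD'D⟩ := diagonal_mul_diagonal_eq_one (N := N) hdd
  rw [show Matrix.diagonal ![1, (d' : ZMod N)] *
        (Matrix.diagonal ![1, (d : ZMod N)] * (g : Matrix (Fin 2) (Fin 2) (ZMod N)) * Matrix.diagonal ![1, (d' : ZMod N)]) *
        Matrix.diagonal ![1, (d : ZMod N)] =
      (Matrix.diagonal ![1, (d' : ZMod N)] * Matrix.diagonal ![1, (d : ZMod N)]) * (g : Matrix (Fin 2) (Fin 2) (ZMod N)) *
        (Matrix.diagonal ![1, (d' : ZMod N)] * Matrix.diagonal ![1, (d : ZMod N)]) by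
      simp only [Matrix.mul_assoc], hD'D, Matrix.one_mul, Matrix.mul_one]

/-- `det (D g D') = 1`: the inverse conjugation also lands in `SL₂(ℤ/Nℤ)`.
[cite: ShimuraIATAF1971, §6.2 (the elements `ι(1,d)` of `GL₂(ℤ/Nℤ)`)] -/
theorem det_diagonal_conj' (hdd : ((d * d' : ℤ) : ZMod N) = 1) (g : SL(2, ZMod N)) :
    (Matrix.diagonal ![1, (d : ZMod N)] * (g : Matrix (Fin 2) (Fin 2) (ZMod N)) * Matrix.diagonal ![1, (d' : ZMod N)]).det = 1 := by
  have hdd' : ((d' * d : ℤ) : ZMod N) = 1 := by rw [mul_comm]; exact hdd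
  exact det_diagonal_conj hdd' g

/-- Entrywise description: `γ' ≡ (a, db; d'c, δ) (mod N)` for `γ = (a, b; c, δ)` means
`γ̄' = D' γ̄ D`. [cite: ShimuraIATAF1971, §6.2 (the elements `ι(1,d)` of `GL₂(ℤ/Nℤ)`)] -/
theorem map_eq_diagConj_of_entries [NeZero N] (hdd : ((d * d' : ℤ) : ZMod N) = 1) {γ γ' : SL(2, ℤ)}
    (h00 : ((γ' 0 0 : ℤ) : ZMod N) = ((γ 0 0 : ℤ) : ZMod N))
    (h01 : ((γ' 0 1 : ℤ) : ZMod N) = (d : ZMod N) * ((γ 0 1 : ℤ) : ZMod N))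
    (h10 : ((γ' 1 0 : ℤ) : ZMod N) = (d' : ZMod N) * ((γ 1 0 : ℤ) : ZMod N))
    (h11 : ((γ' 1 1 : ℤ) : ZMod N) = ((γ 1 1 : ℤ) : ZMod N)) :
    (Matrix.SpecialLinearGroup.map (Int.castRingHom (ZMod N))) γ' =
      ⟨Matrix.diagonal ![1, (d' : ZMod N)] *
          (((Matrix.SpecialLinearGroup.map (Int.castRingHom (ZMod N))) γ : SL(2, ZMod N)) : Matrix (Fin 2) (Fin 2) (ZMod N)) *
          Matrix.diagonal ![1, (d : ZMod N)],
        det_diagonal_conj hdd _⟩ := by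
  have hdd' : (d : ZMod N) * d' = 1 := by push_cast at hdd; exact hdd
  obtain ⟨e00, e01, e10, e11⟩ := diagConj_entries (d := d) (d' := d')
    (((Matrix.SpecialLinearGroup.map (Int.castRingHom (ZMod N))) γ : SL(2, ZMod N)) : Matrix (Fin 2) (Fin 2) (ZMod N))
  apply Subtype.ext
  ext i j
  change ((Matrix.SpecialLinearGroup.map (Int.castRingHom (ZMod N))) γ' : Matrix (Fin 2) (Fin 2) (ZMod N)) i j = _
  refine Fin.cases ?_ (fun i' ↦ ?_) i <;> [skip; (obtain rfl : i' = 0 := Subsingleton.elim _ _)] <;>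
    refine Fin.cases ?_ (fun j' ↦ ?_) j <;>
      [skip; (obtain rfl : j' = 0 := Subsingleton.elim _ _); skip; (obtain rfl : j' = 0 := Subsingleton.elim _ _)]
  · rw [specialLinearGroup_map_apply, h00]; exact (e00.trans (specialLinearGroup_map_apply γ 0 0)).symm
  · change ((γ' 0 1 : ℤ) : ZMod N) = (Matrix.diagonal ![1, (d' : ZMod N)] *
        (((Matrix.SpecialLinearGroup.map (Int.castRingHom (ZMod N))) γ : SL(2, ZMod N)) : Matrix (Fin 2) (Fin 2) (ZMod N)) *
        Matrix.diagonal ![1, (d : ZMod N)]) 0 1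
    rw [h01, e01, specialLinearGroup_map_apply, mul_comm]
  · change ((γ' 1 0 : ℤ) : ZMod N) = (Matrix.diagonal ![1, (d' : ZMod N)] *
        (((Matrix.SpecialLinearGroup.map (Int.castRingHom (ZMod N))) γ : SL(2, ZMod N)) : Matrix (Fin 2) (Fin 2) (ZMod N)) *
        Matrix.diagonal ![1, (d : ZMod N)]) 1 0
    rw [h10, e10, specialLinearGroup_map_apply]
  · change ((γ' 1 1 : ℤ) : ZMod N) = (Matrix.diagonal ![1, (d' : ZMod N)] *
        (((Matrix.SpecialLinearGroup.map (Int.castRingHom (ZMod N))) γ : SL(2, ZMod N)) : Matrix (Fin 2) (Fin 2) (ZMod N)) *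
        Matrix.diagonal ![1, (d : ZMod N)]) 1 1
    rw [h11, e11, specialLinearGroup_map_apply]
    linear_combination (-((γ 1 1 : ℤ) : ZMod N)) * hdd'

end Conj

/-! ### Even weight -/

section Even

variable {N : ℕ} [NeZero N] (σ : ℂ →+* ℂ) {d d' : ℤ}

/-- **The Galois action on translates, even weight.**  Let `k` be even, `g ∈ M_k(Γ(N))` with
`σ`-FIXED `q_N`-expansion, `σ(e^{2πi/N}) = e^{2πid/N}`, `dd' ≡ 1 (N)`, and `γ, γ' ∈ SL₂(ℤ)` with
`γ̄' = D' γ̄ D` in `SL₂(ℤ/Nℤ)` (`D = diag(1,d)`, `D' = diag(1,d')`).  Then the `q_N`-expansion of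
`g ∣_k γ'` is `σ` applied to that of `g ∣_k γ`.  (Shimura 1971, §6.2: on `𝔉_N` the automorphism
`σ` acting on Fourier coefficients is `x ↦ x^{ι(1,d)}`, and `(x ∘ γ)^{ι(1,d)} = x^{ι(1,d)} ∘ (D'γD)`.)
[cite: ShimuraIATAF1971, §6.2 Thm. 6.6, Prop. 6.9 and Prop. 6.21] -/
theorem qExpansion_slash_conj_of_even (hσ : σ (cexp (2 * π * Complex.I / N)) = cexp (2 * π * Complex.I * d / N))
    (hdd : ((d * d' : ℤ) : ZMod N) = 1) {k : ℤ} (hk : Even k) {g : ℍ → ℂ}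
    (hg : g ∈ formSpace (CongruenceSubgroup.Gamma N) k)
    (hfix : (qExpansion (N : ℝ) g).map σ = qExpansion (N : ℝ) g) (γ₀ γ₀' : SL(2, ℤ))
    (hγ : (Matrix.SpecialLinearGroup.map (Int.castRingHom (ZMod N))) γ₀' =
      ⟨Matrix.diagonal ![1, (d' : ZMod N)] *
          (((Matrix.SpecialLinearGroup.map (Int.castRingHom (ZMod N))) γ₀ : SL(2, ZMod N)) : Matrix (Fin 2) (Fin 2) (ZMod N)) *
          Matrix.diagonal ![1, (d : ZMod N)], det_diagonal_conj hdd _⟩) :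
    qExpansion (N : ℝ) (g ∣[k] γ₀') = (qExpansion (N : ℝ) (g ∣[k] γ₀)).map σ := by
  classical
  -- the rational subfield and a generic rational `θ`
  set K : Subfield ℂ := (⊥ : IntermediateField ℚ ℂ).toSubfield with hKdef
  have hK : ∀ x ∈ K, σ x = x := fun x hx ↦ ringHom_apply_eq_self_of_mem_bot σ x hx
  haveI : Infinite K := Infinite.of_injective
    (fun n : ℕ ↦ (⟨(n : ℂ), by rw [hKdef, IntermediateField.mem_toSubfield]; exact natCast_mem _ n⟩ : K))
    fun a b h ↦ by simpa using congrArg Subtype.val h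
  obtain ⟨coef, hstab⟩ := exists_generic_theta (K := K) (N := N)
  -- notation: reduction, the conjugation `c : g ↦ D' g D` and its inverse
  set red : SL(2, ℤ) →* SL(2, ZMod N) := Matrix.SpecialLinearGroup.map (Int.castRingHom (ZMod N)) with hred
  let c : SL(2, ZMod N) → SL(2, ZMod N) := fun gg ↦
    ⟨Matrix.diagonal ![1, (d' : ZMod N)] * (gg : Matrix (Fin 2) (Fin 2) (ZMod N)) * Matrix.diagonal ![1, (d : ZMod N)],
      det_diagonal_conj hdd gg⟩
  let cinv : SL(2, ZMod N) → SL(2, ZMod N) := fun gg ↦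
    ⟨Matrix.diagonal ![1, (d : ZMod N)] * (gg : Matrix (Fin 2) (Fin 2) (ZMod N)) * Matrix.diagonal ![1, (d' : ZMod N)],
      det_diagonal_conj' hdd gg⟩
  have hc_mul : ∀ a b, c (a * b) = c a * c b := fun a b ↦ Subtype.ext (by
    simp only [c, Matrix.SpecialLinearGroup.coe_mul]
    exact diagConj_mul hdd _ _)
  have hc_cinv : ∀ a, c (cinv a) = a := fun a ↦ Subtype.ext (diagConj_inv hdd a)
  have hc_one : c 1 = 1 := by
    have h1 : c 1 = c (1 * 1) := by rw [one_mul]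
    rw [hc_mul] at h1
    exact mul_eq_left.mp h1.symm
  have hc_inv : ∀ a, c a⁻¹ = (c a)⁻¹ := fun a ↦
    eq_inv_of_mul_eq_one_left (by rw [← hc_mul, inv_mul_cancel, hc_one])
  have hc_neg : ∀ a, c (-a) = -c a := fun a ↦ by
    apply Subtype.ext
    simp only [c, Matrix.SpecialLinearGroup.coe_neg, Matrix.mul_neg, Matrix.neg_mul]
  -- the translates of `θ` and of `θ'`
  set Θ : SL(2, ZMod N) → ℍ → ℂ := thetaComb K coef with hΘ
  set Θ' : SL(2, ZMod N) → ℍ → ℂ :=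
    thetaComb K (fun v ↦ coef (v ᵥ* Matrix.diagonal ![1, (d' : ZMod N)])) with hΘ'
  have hΘslash : ∀ (gg : SL(2, ZMod N)) (γ : SL(2, ℤ)), Θ gg ∣[(4 : ℤ)] γ = Θ (gg * red γ) :=
    thetaComb_slash coef
  have hΘ'slash : ∀ (gg : SL(2, ZMod N)) (γ : SL(2, ℤ)), Θ' gg ∣[(4 : ℤ)] γ = Θ' (gg * red γ) :=
    thetaComb_slash _
  have hΘmem : ∀ gg, Θ gg ∈ formSpace (CongruenceSubgroup.Gamma N) 4 := fun gg ↦ thetaComb_mem coef gg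
  have hΘ'mem : ∀ gg, Θ' gg ∈ formSpace (CongruenceSubgroup.Gamma N) 4 := fun gg ↦ thetaComb_mem _ gg
  -- THE EISENSTEIN INPUT: `Θ' (c gg)` is the conjugate of `Θ gg`
  have hconj : ∀ gg, qExpansion (N : ℝ) (Θ' (c gg)) = (qExpansion (N : ℝ) (Θ gg)).map σ :=
    fun gg ↦ conj_thetaComb σ hK hσ hdd coef gg
  -- hence `Θ a = Θ b → Θ' (c a) = Θ' (c b)`
  have hΘ'congr : ∀ a b, Θ a = Θ b → Θ' (c a) = Θ' (c b) := fun a b hab ↦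
    eq_of_conj_of_conj σ (hΘ'mem _) (hΘ'mem _) (hconj a) (by rw [hab]; exact hconj b)
  obtain ⟨lift, hlift⟩ : ∃ lift : SL(2, ZMod N) → SL(2, ℤ), ∀ gg, red (lift gg) = gg :=
    ⟨fun gg ↦ (specialLinearGroup_map_surjective N gg).choose,
      fun gg ↦ (specialLinearGroup_map_surjective N gg).choose_spec⟩
  -- compatibility: equal translates of `θ` give equal translates of `g`
  have hcompat : ∀ a b : SL(2, ℤ), Θ 1 ∣[(4 : ℤ)] a = Θ 1 ∣[(4 : ℤ)] b → g ∣[k] a = g ∣[k] b := by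
    intro a b hab
    have h1 : Θ 1 ∣[(4 : ℤ)] (b * a⁻¹) = Θ 1 := by
      rw [SlashAction.slash_mul, ← hab, ← SlashAction.slash_mul, mul_inv_cancel, SlashAction.slash_one]
    have h2 := slash_eq_of_mem_or_neg_mem hk hg (hstab _ h1)
    calc g ∣[k] a = (g ∣[k] (b * a⁻¹)) ∣[k] a := by rw [h2]
      _ = g ∣[k] b := by rw [← SlashAction.slash_mul, inv_mul_cancel_right]
  -- the orbit of `θ` as a finite set of functions, enumerated
  let S : Finset (ℍ → ℂ) := Finset.univ.image Θ
  have hSmem : ∀ gg, Θ gg ∈ S := fun gg ↦ Finset.mem_image_of_mem Θ (Finset.mem_univ gg)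
  have hS : ∀ x ∈ S, ∃ gg, Θ gg = x := fun x hx ↦ by simpa [S] using hx
  let e : S ≃ Fin S.card := S.equivFin
  let s : Fin S.card → ℍ → ℂ := fun i ↦ (e.symm i : ℍ → ℂ)
  have hsS : ∀ i, s i ∈ S := fun i ↦ (e.symm i).2
  have hrep' : ∀ i, ∃ gg, Θ gg = s i := fun i ↦ hS _ (hsS i)
  choose rep hrep using hrep'
  let γi : Fin S.card → SL(2, ℤ) := fun i ↦ lift (rep i)
  have hγi : ∀ i, Θ 1 ∣[(4 : ℤ)] γi i = s i := fun i ↦ by rw [hΘslash, one_mul, hlift, hrep]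
  have hinj : Function.Injective s := fun i j h ↦ e.symm.injective (Subtype.ext h)
  have hclosed : ∀ (γ : SL(2, ℤ)) (x : S), (x : ℍ → ℂ) ∣[(4 : ℤ)] γ ∈ S := by
    intro γ x
    obtain ⟨gg, hgg⟩ := hS _ x.2
    rw [← hgg, hΘslash]
    exact hSmem _
  let φ : SL(2, ℤ) → S → S := fun γ x ↦ ⟨(x : ℍ → ℂ) ∣[(4 : ℤ)] γ, hclosed γ x⟩
  have hφ : ∀ γ, Function.Bijective (φ γ) := fun γ ↦
    (Finite.injective_iff_bijective).mp fun x y h ↦ Subtype.ext (slash_injective 4 γ (congrArg Subtype.val h))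
  let perm : SL(2, ℤ) → Equiv.Perm (Fin S.card) := fun γ ↦ (e.symm.trans (Equiv.ofBijective _ (hφ γ))).trans e
  have hsσ : ∀ γ i, s i ∣[(4 : ℤ)] γ = s (perm γ i) := by
    intro γ i
    simp only [s, perm, Equiv.trans_apply, Equiv.symm_apply_apply, Equiv.ofBijective_apply, φ]
  -- the companions `F_i = g ∣ γ_i`
  let F : Fin S.card → ℍ → ℂ := fun i ↦ g ∣[k] γi i
  have hFσ : ∀ γ i, F i ∣[k] γ = F (perm γ i) := by
    intro γ i
    simp only [F]
    rw [← SlashAction.slash_mul]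
    refine hcompat _ _ ?_
    rw [SlashAction.slash_mul, hγi, hsσ, hγi]
  have hsmem : ∀ i, s i ∈ formSpace (CongruenceSubgroup.Gamma N) 4 := fun i ↦ by rw [← hrep i]; exact hΘmem _
  have hFmem : ∀ i, F i ∈ formSpace (CongruenceSubgroup.Gamma N) k := fun i ↦ slash_mem_formSpace_Gamma hg _
  -- the base point `i₀` (`s_{i₀} = θ`, `F_{i₀} = g`)
  let i₀ : Fin S.card := e ⟨Θ 1, hSmem 1⟩
  have hsi₀ : s i₀ = Θ 1 := by simp [s, i₀]
  have hFi₀ : F i₀ = g := by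
    have : Θ 1 ∣[(4 : ℤ)] γi i₀ = Θ 1 ∣[(4 : ℤ)] (1 : SL(2, ℤ)) := by rw [hγi, hsi₀, SlashAction.slash_one]
    simpa only [F, SlashAction.slash_one] using hcompat _ _ this
  -- THE CONJUGATE DATUM `s'_i = Θ' (c (rep i))`, `γ'_i = lift (c (rep i))`
  let s' : Fin S.card → ℍ → ℂ := fun i ↦ Θ' (c (rep i))
  let γ'i : Fin S.card → SL(2, ℤ) := fun i ↦ lift (c (rep i))
  have hs'mem : ∀ i, s' i ∈ formSpace (CongruenceSubgroup.Gamma N) 4 := fun i ↦ hΘ'mem _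
  have hs'conj : ∀ i, qExpansion (N : ℝ) (s' i) = (qExpansion (N : ℝ) (s i)).map σ := fun i ↦ by
    rw [← hrep i]; exact hconj _
  have hs'inj : Function.Injective s' := by
    intro i j hij
    apply hinj
    refine eq_of_conj_eq_conj σ (hsmem i) (hsmem j) ?_
    rw [← hs'conj, ← hs'conj]
    exact congrArg _ hij
  -- the permutation action on `s'`: `s'_i ∣ γ = s'_{perm γ̃ i}`, `γ̃` a lift of `D γ̄ D'`
  have hs'σ : ∀ γ i, s' i ∣[(4 : ℤ)] γ = s' (perm (lift (cinv (red γ))) i) := by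
    intro γ i
    have hA : Θ (rep i * red (lift (cinv (red γ)))) = Θ (rep (perm (lift (cinv (red γ))) i)) := by
      rw [← hΘslash, hrep, hsσ, hrep]
    have := hΘ'congr _ _ hA
    rw [hc_mul, hlift, hc_cinv] at this
    change Θ' (c (rep i)) ∣[(4 : ℤ)] γ = Θ' (c (rep (perm (lift (cinv (red γ))) i)))
    rw [hΘ'slash, this]
  -- `s'_{i₀} ∣ γ'_i = s'_i`
  have hs'i₀ : ∀ i, s' i₀ ∣[(4 : ℤ)] γ'i i = s' i := by
    intro i
    have hA : Θ (rep i₀ * rep i) = Θ (rep i) := by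
      have h1 : Θ (rep i₀) = Θ 1 := by rw [hrep, hsi₀]
      calc Θ (rep i₀ * rep i) = Θ (rep i₀) ∣[(4 : ℤ)] lift (rep i) := by rw [hΘslash, hlift]
        _ = Θ 1 ∣[(4 : ℤ)] lift (rep i) := by rw [h1]
        _ = Θ (rep i) := by rw [hΘslash, one_mul, hlift]
    have := hΘ'congr _ _ hA
    rw [hc_mul] at this
    change Θ' (c (rep i₀)) ∣[(4 : ℤ)] lift (c (rep i)) = Θ' (c (rep i))
    rw [hΘ'slash, hlift, this]
  -- weights and the Cramer identity `δ² F_i = ∑_l s_i^l M_l`, `M_l = δ·cram_l` of level one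
  set T : ℤ := ∑ j : Fin S.card, (j : ℤ) with hT
  let W : Fin S.card → ℤ := fun l ↦ 4 * T + (k + 4 * (T - l))
  set κ : ℤ := 4 * T + (4 * T + k) with hκ
  have hWκ : ∀ l : Fin S.card, ((l : ℕ) : ℤ) * 4 + W l = κ := fun l ↦ by simp only [W, hκ]; ring
  have hδmem : vdmDet s ∈ formSpace (CongruenceSubgroup.Gamma N) (4 * T) := vdmDet_mem_formSpace hsmem hsσ hinj
  have hδ'mem : vdmDet s' ∈ formSpace (CongruenceSubgroup.Gamma N) (4 * T) := vdmDet_mem_formSpace hs'mem hs'σ hs'inj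
  have hδconj : qExpansion (N : ℝ) (vdmDet s') = (qExpansion (N : ℝ) (vdmDet s)).map σ :=
    conj_vdmDet σ hsmem hs'mem hs'conj
  have hM : ∀ l : Fin S.card, vdmDet s * cram s F l ∈ levelOneSpace (W l) := fun l ↦
    vdmDet_mul_cram_mem_levelOne hsmem hFmem hsσ hFσ l
  choose M' hM'₁ hM'conj using fun l : Fin S.card ↦ exists_levelOne_conj σ N (hM l)
  have hM'Γ : ∀ l, M' l ∈ formSpace (CongruenceSubgroup.Gamma N) (W l) := fun l ↦ mem_formSpace_Gamma_of_levelOne N (hM'₁ l)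
  have hMΓ : ∀ l, vdmDet s * cram s F l ∈ formSpace (CongruenceSubgroup.Gamma N) (W l) := fun l ↦
    mem_formSpace_Gamma_of_levelOne N (hM l)
  have hpow : ∀ (i l : Fin S.card), s i ^ (l : ℕ) ∈ formSpace (CongruenceSubgroup.Gamma N) (((l : ℕ) : ℤ) * 4) :=
    fun i l ↦ pow_mem_formSpace (hsmem i) l
  have hpow' : ∀ (i l : Fin S.card), s' i ^ (l : ℕ) ∈ formSpace (CongruenceSubgroup.Gamma N) (((l : ℕ) : ℤ) * 4) :=
    fun i l ↦ pow_mem_formSpace (hs'mem i) l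
  have hcramer : ∀ i, vdmDet s * (vdmDet s * F i) = ∑ l : Fin S.card, s i ^ (l : ℕ) * (vdmDet s * cram s F l) := by
    intro i
    rw [vdmDet_mul_eq_sum i, Finset.mul_sum]
    refine Finset.sum_congr rfl fun l _ ↦ ?_
    ring
  have hLHSmem : ∀ i, vdmDet s * (vdmDet s * F i) ∈ formSpace (CongruenceSubgroup.Gamma N) κ := fun i ↦
    mul_mem_formSpace hδmem (mul_mem_formSpace hδmem (hFmem i))
  have hRHS'mem : ∀ i, ∑ l : Fin S.card, s' i ^ (l : ℕ) * M' l ∈ formSpace (CongruenceSubgroup.Gamma N) κ := fun i ↦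
    Submodule.sum_mem _ fun l _ ↦ by rw [← hWκ l]; exact mul_mem_formSpace (hpow' i l) (hM'Γ l)
  -- conjugating the Cramer identity: `σ(δ²F_i) = q-exp(∑_l s'_i^l M'_l)`
  have hconjCramer : ∀ i, qExpansion (N : ℝ) (∑ l : Fin S.card, s' i ^ (l : ℕ) * M' l) =
      (qExpansion (N : ℝ) (vdmDet s * (vdmDet s * F i))).map σ := by
    intro i
    rw [hcramer i]
    refine conj_sum σ (k := κ) _ (fun l _ ↦ by rw [← hWκ l]; exact mul_mem_formSpace (hpow i l) (hMΓ l))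
      (fun l _ ↦ by rw [← hWκ l]; exact mul_mem_formSpace (hpow' i l) (hM'Γ l)) fun l _ ↦ ?_
    exact conj_mul σ (hpow i l) (hMΓ l) (hpow' i l) (hM'Γ l) (conj_pow σ (hsmem i) (hs'mem i) (hs'conj i) l) (hM'conj l)
  -- at `i₀`: `δ'² g` is ALSO a conjugate of `δ² F_{i₀} = δ² g`, so `∑_l s'_{i₀}^l M'_l = δ'² g`
  have hg'mem : ∀ γ : SL(2, ℤ), g ∣[k] γ ∈ formSpace (CongruenceSubgroup.Gamma N) k := fun γ ↦ slash_mem_formSpace_Gamma hg γ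
  have hδδg : vdmDet s' * (vdmDet s' * g) ∈ formSpace (CongruenceSubgroup.Gamma N) κ :=
    mul_mem_formSpace hδ'mem (mul_mem_formSpace hδ'mem hg)
  have hid₀ : ∑ l : Fin S.card, s' i₀ ^ (l : ℕ) * M' l = vdmDet s' * (vdmDet s' * g) := by
    refine eq_of_conj_of_conj σ (hRHS'mem i₀) hδδg (hconjCramer i₀) ?_
    rw [hFi₀]
    exact conj_mul σ hδmem (mul_mem_formSpace hδmem hg) hδ'mem (mul_mem_formSpace hδ'mem hg) hδconj
      (conj_mul σ hδmem hg hδ'mem hg hδconj hfix.symm)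
  -- slashing by `γ'_i`: `∑_l s'_i^l M'_l = δ'² (g ∣ γ'_i)`
  have hid : ∀ i, ∑ l : Fin S.card, s' i ^ (l : ℕ) * M' l = vdmDet s' * (vdmDet s' * (g ∣[k] γ'i i)) := by
    intro i
    have hslash : (∑ l : Fin S.card, s' i₀ ^ (l : ℕ) * M' l) ∣[κ] γ'i i = (vdmDet s' * (vdmDet s' * g)) ∣[κ] γ'i i :=
      congrArg (fun f : ℍ → ℂ ↦ f ∣[κ] γ'i i) hid₀
    have hL : (∑ l : Fin S.card, s' i₀ ^ (l : ℕ) * M' l) ∣[κ] γ'i i = ∑ l : Fin S.card, s' i ^ (l : ℕ) * M' l := by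
      rw [SlashAction.sum_slash]
      refine Finset.sum_congr rfl fun l _ ↦ ?_
      rw [← hWκ l, ModularForm.mul_slash_SL2, pow_slash_SL2, hs'i₀,
        show M' l ∣[W l] γ'i i = M' l from slash_eq_of_mem_formSpace (hM'₁ l) (coe_mem_SL _)]
    have hR : (vdmDet s' * (vdmDet s' * g)) ∣[κ] γ'i i = vdmDet s' * (vdmDet s' * (g ∣[k] γ'i i)) := by
      rw [hκ, ModularForm.mul_slash_SL2, ModularForm.mul_slash_SL2, vdmDet_slash (γ'i i) (perm (lift (cinv (red (γ'i i))))) (hs'σ _),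
        smul_mul_assoc, smul_mul_assoc, mul_smul_comm, smul_smul, sign_mul_sign, one_smul]
    rw [hL, hR] at hslash
    exact hslash
  -- division by `δ'² = σ(δ²)`: `σ(F_i) = g ∣ γ'_i`
  have hδ0 : vdmDet s ≠ 0 := vdmDet_ne_zero (fun i ↦ mdifferentiable_of_mem_formSpace (hsmem i)) hinj
  have hδδ0 : vdmDet s * vdmDet s ≠ 0 := fun h ↦ hδ0 (eq_zero_of_mul_eq_zero_of_mdifferentiable
    (mdifferentiable_of_mem_formSpace hδmem) hδ0 (mdifferentiable_of_mem_formSpace hδmem).continuous h)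
  have hmain : ∀ i, qExpansion (N : ℝ) (g ∣[k] γ'i i) = (qExpansion (N : ℝ) (F i)).map σ := by
    intro i
    refine conj_of_mul_left σ (mul_mem_formSpace hδmem hδmem) (hFmem i) (mul_mem_formSpace hδ'mem hδ'mem) (hg'mem _)
      hδδ0 (mul_assoc _ _ _) (mul_assoc _ _ _) (conj_mul σ hδmem hδmem hδ'mem hδ'mem hδconj hδconj) ?_
    rw [← hid i]
    exact hconjCramer i
  -- reading off `γ₀`: the index `i₁` with `s_{i₁} = θ ∣ γ₀`, `F_{i₁} = g ∣ γ₀`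
  let i₁ : Fin S.card := e ⟨Θ 1 ∣[(4 : ℤ)] γ₀, by rw [hΘslash]; exact hSmem _⟩
  have hsi₁ : s i₁ = Θ 1 ∣[(4 : ℤ)] γ₀ := by simp [s, i₁]
  have hFi₁ : F i₁ = g ∣[k] γ₀ := hcompat _ _ (by rw [hγi, hsi₁])
  -- `γ₀' ≡ ±γ'_{i₁}` modulo `Γ(N)`: both `γ₀ (lift (rep i₁))⁻¹` fixes `θ`
  have hfixθ : Θ 1 ∣[(4 : ℤ)] (γ₀ * (lift (rep i₁))⁻¹) = Θ 1 := by
    have h1 : Θ 1 ∣[(4 : ℤ)] γ₀ = Θ 1 ∣[(4 : ℤ)] lift (rep i₁) := by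
      rw [← hsi₁, hΘslash, one_mul, hlift, hrep]
    rw [SlashAction.slash_mul, h1, ← SlashAction.slash_mul, mul_inv_cancel, SlashAction.slash_one]
  have hpm := hstab _ hfixθ
  -- hence `red γ₀' = ± red (γ'_{i₁})`, and `g ∣ γ₀' = g ∣ γ'_{i₁}`
  have hred_γ₀' : red γ₀' = c (red γ₀) := hγ
  have hred_γ'i : red (γ'i i₁) = c (rep i₁) := hlift _
  have hredB : red (γ₀' * (γ'i i₁)⁻¹) = c (red (γ₀ * (lift (rep i₁))⁻¹)) := by
    rw [map_mul, map_inv, map_mul, map_inv, hred_γ₀', hred_γ'i, hc_mul, hc_inv, hlift]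
  have hred_neg : ∀ γ : SL(2, ℤ), red (-γ) = -red γ := fun γ ↦ specialLinearGroup_map_neg γ
  have hrel : γ₀' * (γ'i i₁)⁻¹ ∈ CongruenceSubgroup.Gamma N ∨ -(γ₀' * (γ'i i₁)⁻¹) ∈ CongruenceSubgroup.Gamma N := by
    rcases hpm with h | h
    · left
      rw [CongruenceSubgroup.Gamma_mem'] at h ⊢
      change red (γ₀ * (lift (rep i₁))⁻¹) = 1 at h
      change red (γ₀' * (γ'i i₁)⁻¹) = 1
      rw [hredB, h, hc_one]
    · right
      rw [CongruenceSubgroup.Gamma_mem'] at h ⊢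
      change red (-(γ₀ * (lift (rep i₁))⁻¹)) = 1 at h
      change red (-(γ₀' * (γ'i i₁)⁻¹)) = 1
      rw [hred_neg, neg_eq_iff_eq_neg] at h
      rw [hred_neg, hredB, h, hc_neg, hc_one, neg_neg]
  have hgeq : g ∣[k] γ₀' = g ∣[k] γ'i i₁ := by
    have h2 := slash_eq_of_mem_or_neg_mem hk hg hrel
    calc g ∣[k] γ₀' = (g ∣[k] (γ₀' * (γ'i i₁)⁻¹)) ∣[k] γ'i i₁ := by
          rw [← SlashAction.slash_mul, inv_mul_cancel_right]
      _ = g ∣[k] γ'i i₁ := by rw [h2]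
  rw [hgeq, hmain i₁, hFi₁]

end Even

/-! ### All weights -/

section All

variable {N : ℕ} [NeZero N] (σ : ℂ →+* ℂ) {d d' : ℤ}

/-- **The `q`-expansion principle for `SL₂(ℤ)`-translates, Galois-action half** (all weights).
For a ring endomorphism `σ` of `ℂ` with `σ(e^{2πi/N}) = e^{2πid/N}`, `dd' ≡ 1 (N)`, a form
`g ∈ M_k(Γ(N))` whose `q_N`-expansion is fixed by `σ`, and `γ = (a, b; c, δ)`, `γ' ∈ SL₂(ℤ)` with
`γ' ≡ (a, db; d'c, δ) (mod N)`:  **`qExpansion N (g ∣_k γ') = σ(qExpansion N (g ∣_k γ))`**.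
(Shimura 1971, §6.2: `σ` acts on `𝔉_N` as `ι(1,d)`, and `(x ∘ γ)^{ι(1,d)} = x^{ι(1,d)} ∘ (ι(1,d)⁻¹γι(1,d))`;
Diamond–Shurman §7.7; the case `γ = (1,0;y,1)`, `γ' = (1,0;d'y,1)` is Stevens 1982 Thm. 1.3.1 (b).)
Odd weight: for `N ≥ 3` multiply by the `σ`-fixed `c₃G_3^{(1,0)}` with non-vanishing translates and
divide; for `N ∣ 2` odd-weight forms vanish. [cite: ShimuraIATAF1971, §6.2 Thm. 6.6, Prop. 6.9 and Prop. 6.21]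
[cite: DiamondShurman2005, §7.7] -/
theorem qExpansion_slash_conj (hσ : σ (cexp (2 * π * Complex.I / N)) = cexp (2 * π * Complex.I * d / N))
    (hdd : ((d * d' : ℤ) : ZMod N) = 1) {k : ℤ} {g : ℍ → ℂ}
    (hg : g ∈ formSpace (CongruenceSubgroup.Gamma N) k)
    (hfix : (qExpansion (N : ℝ) g).map σ = qExpansion (N : ℝ) g) {γ γ' : SL(2, ℤ)}
    (h00 : ((γ' 0 0 : ℤ) : ZMod N) = ((γ 0 0 : ℤ) : ZMod N))
    (h01 : ((γ' 0 1 : ℤ) : ZMod N) = (d : ZMod N) * ((γ 0 1 : ℤ) : ZMod N))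
    (h10 : ((γ' 1 0 : ℤ) : ZMod N) = (d' : ZMod N) * ((γ 1 0 : ℤ) : ZMod N))
    (h11 : ((γ' 1 1 : ℤ) : ZMod N) = ((γ 1 1 : ℤ) : ZMod N)) :
    qExpansion (N : ℝ) (g ∣[k] γ') = (qExpansion (N : ℝ) (g ∣[k] γ)).map σ := by
  have hγ := map_eq_diagConj_of_entries hdd h00 h01 h10 h11
  rcases Int.even_or_odd k with hk | hk
  · exact qExpansion_slash_conj_of_even σ hσ hdd hk hg hfix γ γ' hγ
  by_cases hN : 3 ≤ N
  · -- the odd-weight multiplier `E₃ = c₃ G_3^{(1,0)}` and its translates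
    have hζ : cexp (2 * π * Complex.I / N) ∈ (⊤ : Subfield ℂ) := Subfield.mem_top _
    set E₃ : ℍ → ℂ := latticeEisensteinNorm N 3 • latticeEisenstein N 3 (![1, 0] : Fin 2 → ZMod N) with hE₃
    obtain ⟨hE₃mem, -, -⟩ := eisThree_slash_spec hζ hN 1
    rw [SlashAction.slash_one] at hE₃mem
    obtain ⟨hγmem, -, hγne⟩ := eisThree_slash_spec hζ hN γ
    obtain ⟨hγ'mem, -, -⟩ := eisThree_slash_spec hζ hN γ'
    have hslashE : ∀ δ : SL(2, ℤ), E₃ ∣[(3 : ℤ)] δ = latticeEisensteinNorm N 3 •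
        latticeEisenstein N 3 ((![1, 0] : Fin 2 → ZMod N) ᵥ*
          (((Matrix.SpecialLinearGroup.map (Int.castRingHom (ZMod N))) δ : SL(2, ZMod N)) : Matrix (Fin 2) (Fin 2) (ZMod N))) :=
      fun δ ↦ by rw [hE₃, ModularForm.SL_smul_slash, latticeEisenstein_slash]
    have hrow : ∀ δ : SL(2, ℤ), (![1, 0] : Fin 2 → ZMod N) ᵥ*
        (((Matrix.SpecialLinearGroup.map (Int.castRingHom (ZMod N))) δ : SL(2, ZMod N)) : Matrix (Fin 2) (Fin 2) (ZMod N)) =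
        ![((δ 0 0 : ℤ) : ZMod N), ((δ 0 1 : ℤ) : ZMod N)] := fun δ ↦ by
      ext j; fin_cases j <;> simp [Matrix.vecMul, dotProduct, Fin.sum_univ_two]
    -- `E₃` is `σ`-fixed and `E₃ ∣ γ'` is the conjugate of `E₃ ∣ γ`
    have hE₃fix : (qExpansion (N : ℝ) E₃).map σ = qExpansion (N : ℝ) E₃ := by
      have h := conj_latticeEisenstein_smul σ hσ (le_refl 3) (![1, 0] : Fin 2 → ZMod N)
      simp only [Matrix.cons_val_zero, Matrix.cons_val_one, Matrix.cons_val_fin_one, mul_zero] at h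
      exact h.symm
    have hE₃conj : qExpansion (N : ℝ) (E₃ ∣[(3 : ℤ)] γ') = (qExpansion (N : ℝ) (E₃ ∣[(3 : ℤ)] γ)).map σ := by
      rw [hslashE, hslashE, hrow, hrow, h00, h01]
      have h := conj_latticeEisenstein_smul σ hσ (le_refl 3) (![((γ 0 0 : ℤ) : ZMod N), ((γ 0 1 : ℤ) : ZMod N)])
      simp only [Matrix.cons_val_zero, Matrix.cons_val_one, Matrix.cons_val_fin_one] at h
      exact h
    -- even weight for `g · E₃`
    have hgE : g * E₃ ∈ formSpace (CongruenceSubgroup.Gamma N) (k + 3) := mul_mem_formSpace hg hE₃mem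
    have hgEfix : (qExpansion (N : ℝ) (g * E₃)).map σ = qExpansion (N : ℝ) (g * E₃) :=
      (conj_mul σ hg hE₃mem hg hE₃mem hfix.symm hE₃fix.symm).symm
    have heven : Even (k + 3) := hk.add_odd (by decide)
    have hmain := qExpansion_slash_conj_of_even σ hσ hdd heven hgE hgEfix γ γ' hγ
    rw [ModularForm.mul_slash_SL2, ModularForm.mul_slash_SL2] at hmain
    exact conj_of_mul_left σ hγmem (slash_mem_formSpace_Gamma hg γ) hγ'mem (slash_mem_formSpace_Gamma hg γ')
      hγne (mul_comm _ _) (mul_comm _ _) hE₃conj hmain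
  · have hN' : N = 1 ∨ N = 2 := by
      have := NeZero.pos N
      omega
    have h0 : g = 0 := by
      have := formSpace_eq_bot_of_odd (neg_one_mem_Gamma hN') hk
      rw [this] at hg
      exact hg
    rw [h0, SlashAction.zero_slash, SlashAction.zero_slash, qExpansion_zero, map_zero]

end All

end Literature.NumberTheory.ModularForms

end
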